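import Literature.NumberTheory.LFunctions.RiemannSiegelFacts
import HarnessLib

/-!
# Discharged facts: the phase identity for `θ` and the reality of `e^{iθ(t)} ζ(1/2 + it)`

`Literature.NumberTheory.LFunctions.RiemannSiegel` defines the Riemann–Siegel theta function as
`θ(t) = ∫₀ᵗ θ'(u) du` with `θ'(u) = Re ψ(1/4 + iu/2)/2 − (log π)/2` (`ψ = Γ'/Γ`), Hardy's
`Z(t) = Re (e^{iθ(t)} ζ(1/2 + it))`, and records as named facts (`def … : Prop`) that this `θ`
really is a continuous argument of `π^{-it/2} Γ(1/4 + it/2)` and that `e^{iθ} ζ(1/2 + it)` is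
real. This file discharges those facts and their consequences for `Z`:

* `cexp_riemannSiegelTheta_mul_I_holds` — the **phase identity**
  `e^{iθ(t)} = π^{-it/2} Γ(1/4 + it/2) / |Γ(1/4 + it/2)|` (Titchmarsh (4.17.2); Edwards §6.5);
* `im_cexp_theta_mul_zeta_eq_zero_holds` — `Im (e^{iθ(t)} ζ(1/2 + it)) = 0`;
* `ofReal_hardyZ_holds`, `abs_hardyZ_eq_norm_riemannZeta_holds`, `hardyZ_eq_zero_iff_holds` —
  `(Z(t) : ℂ) = e^{iθ(t)} ζ(1/2 + it)`, `|Z(t)| = |ζ(1/2 + it)|`, `Z(t) = 0 ↔ ζ(1/2 + it) = 0`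
  (their interim proofs, preserved as comments in `RiemannSiegel.lean`, are replayed here).

## Proof of the phase identity

Put `s(t) = 1/4 + it/2` (`thetaArg`) and `G(s) = π^{-(s − 1/4)} Γ(s)` (`thetaGamma`, entire on
`re s > 0`, non-vanishing), so that `π^{-it/2} Γ(1/4 + it/2) = G(s(t))` and
`G'/G = ψ − log π`. Let `r(t) = −Im ψ(s(t))/2` (`thetaLogNormDeriv`) and `R(t) = ∫₀ᵗ r`
(`thetaLogNorm`). The function `v(t) = G(s(t)) e^{−iθ(t) − R(t)}` (`thetaAux`) is differentiable
with `v'/v = (ψ − log π)(i/2) − iθ'(t) − r(t) = 0` (`hasDerivAt_thetaAux`), hence constant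
(`is_const_of_deriv_eq_zero`), `v ≡ v(0) = Γ(1/4) > 0`. Therefore
`G(s(t)) = Γ(1/4) e^{iθ(t) + R(t)}`, `|G(s(t))| = Γ(1/4) e^{R(t)}`, and
`G(s(t)) / |G(s(t))| = e^{iθ(t)}`; finally `|G(s(t))| = |Γ(s(t))|` because `π^{-it/2}` is
unimodular. No branch of `log Γ` is ever chosen.

## Proof of the reality of `e^{iθ} ζ`

With Deligne's `Γ_ℝ(s) = π^{-s/2} Γ(s/2)` (Mathlib `Complex.Gammaℝ`) and the completed zeta
function `Λ = Γ_ℝ ζ` (Mathlib `completedRiemannZeta`, `riemannZeta_def_of_ne_zero`): on the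
critical line `1 − s = s̄`, so `Λ(s) = Λ(1 − s) = Λ(s̄) = conj Λ(s)` is real
(`completedRiemannZeta_one_sub`, `riemannZeta_conj`, `Gammaℝ_conj`); and
`Γ_ℝ(1/2 + it) = π^{-1/4} G(s(t))`, whence
`e^{iθ(t)} ζ(1/2 + it) = π^{1/4} Λ(1/2 + it) / |G(s(t))| ∈ ℝ`.

## References

* E. C. Titchmarsh, *The Theory of the Riemann Zeta-Function*, 2nd ed. (1986), §2.1 (functional
  equation in symmetric form), §4.17 (`θ`, `Z`, eq. (4.17.2)).
* H. M. Edwards, *Riemann's Zeta Function* (1974), §6.5.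
-/

noncomputable section

open Complex Filter Set
open scoped Real Topology ComplexConjugate

namespace Literature.NumberTheory.LFunctions

/-! ## The functions `s(t)`, `G(s)`, `r(t)`, `R(t)` -/

/-- The argument `s(t) = 1/4 + it/2` at which `Γ` enters `θ(t)`. [folklore] -/
def thetaArg (t : ℝ) : ℂ := 1 / 4 + t / 2 * I

/-- `re s(t) = 1/4`. [folklore] -/
@[simp] theorem thetaArg_re (t : ℝ) : (thetaArg t).re = 1 / 4 := by simp [thetaArg]

/-- `im s(t) = t/2`. [folklore] -/
@[simp] theorem thetaArg_im (t : ℝ) : (thetaArg t).im = t / 2 := by simp [thetaArg]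

/-- `s(t)` lies in the open right half-plane. [folklore] -/
theorem thetaArg_re_pos (t : ℝ) : 0 < (thetaArg t).re := by simp

/-- `s(0) = 1/4` (a real point). [folklore] -/
theorem thetaArg_zero : thetaArg 0 = ((1 / 4 : ℝ) : ℂ) := by
  simp [thetaArg]

/-- `ds/dt = i/2`. [folklore] -/
theorem hasDerivAt_thetaArg (t : ℝ) : HasDerivAt thetaArg (1 / 2 * I) t := by
  unfold thetaArg
  have h1 : HasDerivAt (fun t : ℝ ↦ (t : ℂ)) 1 t := (hasDerivAt_id t).ofReal_comp
  have h2 := (h1.div_const 2).mul_const I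
  simpa using h2.const_add (1 / 4 : ℂ)

/-- `G(s) = π^{-(s - 1/4)} Γ(s)`, written with `cexp` and the real logarithm of `π`; on the line
`s = s(t)` it is `π^{-it/2} Γ(1/4 + it/2)` (`thetaGamma_thetaArg_eq_cpow`). [folklore] -/
def thetaGamma (s : ℂ) : ℂ := cexp (-(s - 1 / 4) * (Real.log π : ℂ)) * Complex.Gamma s

/-- `Γ' = ψ Γ` on the open right half-plane (`ψ = Γ'/Γ = Complex.digamma`, `Γ ≠ 0` there).
[folklore] -/
theorem hasDerivAt_Gamma_of_re_pos {s : ℂ} (hs : 0 < s.re) :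
    HasDerivAt Complex.Gamma (Complex.digamma s * Complex.Gamma s) s := by
  have hd : DifferentiableAt ℂ Complex.Gamma s := by
    refine Complex.differentiableAt_Gamma s fun m hm ↦ ?_
    have := congrArg Complex.re hm
    simp at this
    linarith [(Nat.cast_nonneg m : (0 : ℝ) ≤ m)]
  have hne : Complex.Gamma s ≠ 0 := Complex.Gamma_ne_zero_of_re_pos hs
  have h := hd.hasDerivAt
  have e : deriv Complex.Gamma s = Complex.digamma s * Complex.Gamma s := by
    rw [Complex.digamma_def, logDeriv_apply, div_mul_cancel₀ _ hne]
  rwa [e] at h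

/-- `G' = G · (ψ − log π)` on the open right half-plane. [folklore] -/
theorem hasDerivAt_thetaGamma {s : ℂ} (hs : 0 < s.re) :
    HasDerivAt thetaGamma (thetaGamma s * (Complex.digamma s - Real.log π)) s := by
  unfold thetaGamma
  have h1 : HasDerivAt (fun s : ℂ ↦ -(s - 1 / 4) * (Real.log π : ℂ)) (-(Real.log π : ℂ)) s := by
    simpa using ((hasDerivAt_id s).sub_const (1 / 4 : ℂ)).neg.mul_const (Real.log π : ℂ)
  have h2 := h1.cexp
  refine (h2.mul (hasDerivAt_Gamma_of_re_pos hs)).congr_deriv ?_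
  ring

/-- `r(t) = −Im ψ(s(t)) / 2`, which will be the logarithmic derivative of `|G(s(t))|`.
[folklore] -/
def thetaLogNormDeriv (t : ℝ) : ℝ := -(Complex.digamma (thetaArg t)).im / 2

/-- `t ↦ ψ(s(t))` is continuous (`ψ` is continuous on the open right half-plane,
`continuousAt_digamma_of_re_pos`). [folklore] -/
theorem continuous_digamma_thetaArg : Continuous fun t : ℝ ↦ Complex.digamma (thetaArg t) :=
  continuous_iff_continuousAt.2 fun t ↦
    (continuousAt_digamma_of_re_pos (thetaArg_re_pos t)).comp (hasDerivAt_thetaArg t).continuousAt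

/-- `r` is continuous. [folklore] -/
theorem continuous_thetaLogNormDeriv : Continuous thetaLogNormDeriv :=
  ((Complex.continuous_im.comp continuous_digamma_thetaArg).neg.div_const 2)

/-- `R(t) = ∫₀ᵗ r(u) du` (it will turn out that `|G(s(t))| = Γ(1/4) e^{R(t)}`). [folklore] -/
def thetaLogNorm (t : ℝ) : ℝ := ∫ u in (0 : ℝ)..t, thetaLogNormDeriv u

/-- `R' = r` (fundamental theorem of calculus). [folklore] -/
theorem hasDerivAt_thetaLogNorm (t : ℝ) : HasDerivAt thetaLogNorm (thetaLogNormDeriv t) t :=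
  (continuous_thetaLogNormDeriv.integral_hasStrictDerivAt 0 t).hasDerivAt

/-- `R(0) = 0`. [folklore] -/
@[simp] theorem thetaLogNorm_zero : thetaLogNorm 0 = 0 := by simp [thetaLogNorm]

/-! ## The auxiliary function `v(t) = G(s(t)) e^{-iθ(t) - R(t)}` is constant -/

/-- `v(t) = G(s(t)) e^{−iθ(t) − R(t)}`. [folklore] -/
def thetaAux (t : ℝ) : ℂ :=
  thetaGamma (thetaArg t) * cexp (-((riemannSiegelTheta t : ℂ) * I) - (thetaLogNorm t : ℂ))

/-- `θ'(t) = Re ψ(s(t))/2 − (log π)/2` (definitional). [folklore] -/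
theorem riemannSiegelThetaDeriv_eq (t : ℝ) :
    riemannSiegelThetaDeriv t = (Complex.digamma (thetaArg t)).re / 2 - Real.log π / 2 := rfl

/-- **`v' = 0`.** With `ψ = ψ(s(t))`: `v'/v = (ψ − log π)(i/2) − i θ'(t) − r(t)`
`= (ψ − log π)(i/2) − i (Re ψ/2 − (log π)/2) + Im ψ/2 = (ψ − Re ψ − i Im ψ)(i/2) = 0`. [folklore] -/
theorem hasDerivAt_thetaAux (t : ℝ) : HasDerivAt thetaAux 0 t := by
  have hG : HasDerivAt (fun t : ℝ ↦ thetaGamma (thetaArg t))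
      (thetaGamma (thetaArg t) * (Complex.digamma (thetaArg t) - Real.log π) * (1 / 2 * I)) t :=
    (hasDerivAt_thetaGamma (thetaArg_re_pos t)).comp t (hasDerivAt_thetaArg t)
  have hθ : HasDerivAt (fun t : ℝ ↦ (riemannSiegelTheta t : ℂ)) (riemannSiegelThetaDeriv t : ℂ) t :=
    (hasDerivAt_riemannSiegelTheta_holds t).ofReal_comp
  have hR : HasDerivAt (fun t : ℝ ↦ (thetaLogNorm t : ℂ)) (thetaLogNormDeriv t : ℂ) t :=
    (hasDerivAt_thetaLogNorm t).ofReal_comp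
  have hE : HasDerivAt (fun t : ℝ ↦ -((riemannSiegelTheta t : ℂ) * I) - (thetaLogNorm t : ℂ))
      (-((riemannSiegelThetaDeriv t : ℂ) * I) - (thetaLogNormDeriv t : ℂ)) t :=
    (hθ.mul_const I).neg.sub hR
  have hprod := hG.mul hE.cexp
  refine hprod.congr_deriv ?_
  set ψ := Complex.digamma (thetaArg t) with hψdef
  rw [riemannSiegelThetaDeriv_eq, thetaLogNormDeriv, ← hψdef]
  set E := cexp (-((riemannSiegelTheta t : ℂ) * I) - (thetaLogNorm t : ℂ))
  set A := thetaGamma (thetaArg t)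
  have key : (ψ - (Real.log π : ℂ)) * (1 / 2 * I)
      + (-(((ψ.re / 2 - Real.log π / 2 : ℝ) : ℂ) * I) - ((-ψ.im / 2 : ℝ) : ℂ)) = 0 := by
    apply Complex.ext
    · simp
      ring
    · simp
      ring
  linear_combination (A * E) * key

/-- `v` is constant: `v(t) = v(0)`. [folklore] -/
theorem thetaAux_eq_thetaAux_zero (t : ℝ) : thetaAux t = thetaAux 0 := by
  have hdiff : Differentiable ℝ thetaAux := fun t ↦ (hasDerivAt_thetaAux t).differentiableAt
  exact is_const_of_deriv_eq_zero hdiff (fun t ↦ (hasDerivAt_thetaAux t).deriv) t 0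

/-- `v(0) = Γ(1/4)` (`θ(0) = R(0) = 0`, `G(1/4) = Γ(1/4)`). [folklore] -/
theorem thetaAux_zero : thetaAux 0 = (Real.Gamma (1 / 4) : ℂ) := by
  rw [thetaAux, thetaArg_zero, thetaGamma, Complex.Gamma_ofReal]
  push_cast
  simp

/-- **`G(s(t)) = Γ(1/4) e^{iθ(t) + R(t)}`.** [folklore] -/
theorem thetaGamma_thetaArg_eq (t : ℝ) :
    thetaGamma (thetaArg t) =
      (Real.Gamma (1 / 4) : ℂ) * cexp ((riemannSiegelTheta t : ℂ) * I + (thetaLogNorm t : ℂ)) := by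
  have h := thetaAux_eq_thetaAux_zero t
  rw [thetaAux_zero] at h
  unfold thetaAux at h
  calc thetaGamma (thetaArg t)
      = thetaGamma (thetaArg t) * cexp (-((riemannSiegelTheta t : ℂ) * I) - (thetaLogNorm t : ℂ))
          * cexp ((riemannSiegelTheta t : ℂ) * I + (thetaLogNorm t : ℂ)) := by
        rw [mul_assoc, ← Complex.exp_add]
        ring_nf
        simp
    _ = (Real.Gamma (1 / 4) : ℂ)
          * cexp ((riemannSiegelTheta t : ℂ) * I + (thetaLogNorm t : ℂ)) := by rw [h]

/-- `Γ(1/4) > 0`. [folklore] -/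
theorem Real_Gamma_quarter_pos : 0 < Real.Gamma (1 / 4) := Real.Gamma_pos_of_pos (by norm_num)

/-- `|G(s(t))| = Γ(1/4) e^{R(t)}`. [folklore] -/
theorem norm_thetaGamma_thetaArg (t : ℝ) :
    ‖thetaGamma (thetaArg t)‖ = Real.Gamma (1 / 4) * Real.exp (thetaLogNorm t) := by
  rw [thetaGamma_thetaArg_eq, norm_mul, Complex.norm_real, Complex.norm_exp,
    Real.norm_of_nonneg Real_Gamma_quarter_pos.le]
  simp

/-- The phase identity in terms of `G`: `e^{iθ(t)} = G(s(t)) / |G(s(t))|`. [folklore] -/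
theorem cexp_theta_mul_I_eq_thetaGamma_div_norm (t : ℝ) :
    cexp (riemannSiegelTheta t * I) = thetaGamma (thetaArg t) / ‖thetaGamma (thetaArg t)‖ := by
  have hΓ : (Real.Gamma (1 / 4) : ℂ) ≠ 0 := by exact_mod_cast Real_Gamma_quarter_pos.ne'
  have hexp : cexp (thetaLogNorm t : ℂ) ≠ 0 := Complex.exp_ne_zero _
  rw [norm_thetaGamma_thetaArg, thetaGamma_thetaArg_eq]
  push_cast
  rw [Complex.exp_add]
  field_simp

/-- `|G(s(t))| = |Γ(s(t))|`: the prefactor `π^{-it/2}` is unimodular. [folklore] -/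
theorem norm_thetaGamma_thetaArg_eq_norm_Gamma (t : ℝ) :
    ‖thetaGamma (thetaArg t)‖ = ‖Complex.Gamma (thetaArg t)‖ := by
  rw [thetaGamma, norm_mul, Complex.norm_exp]
  simp [thetaArg]

/-- `G(s(t)) = π^{-it/2} Γ(1/4 + it/2)`, in the notation of the named fact
(`Complex.cpow_def_of_ne_zero`, `Complex.ofReal_log`). [folklore] -/
theorem thetaGamma_thetaArg_eq_cpow (t : ℝ) :
    thetaGamma (thetaArg t) = (π : ℂ) ^ (-(t : ℂ) * I / 2) * Complex.Gamma (1 / 4 + t / 2 * I) := by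
  have hπ : (π : ℂ) ≠ 0 := by exact_mod_cast Real.pi_pos.ne'
  rw [thetaGamma, thetaArg, Complex.cpow_def_of_ne_zero hπ, ← Complex.ofReal_log Real.pi_pos.le]
  congr 1
  congr 1
  ring

/-- **Discharge of `Literature.NumberTheory.LFunctions.cexp_riemannSiegelTheta_mul_I`** (the phase identity, Titchmarsh §4.17
eq. (4.17.2); Edwards §6.5): `e^{iθ(t)} = π^{-it/2} Γ(1/4 + it/2) / |Γ(1/4 + it/2)|` for all real
`t`, for the tree's `θ = ∫₀ᵗ θ'`. [cite: Titchmarsh1986, §4.17 eq. (4.17.2)] -/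
theorem cexp_riemannSiegelTheta_mul_I_holds : cexp_riemannSiegelTheta_mul_I := by
  intro t
  rw [cexp_theta_mul_I_eq_thetaGamma_div_norm, norm_thetaGamma_thetaArg_eq_norm_Gamma,
    thetaGamma_thetaArg_eq_cpow]
  rfl

/-! ## `e^{iθ(t)} ζ(1/2 + it)` is real -/

/-- `Γ_ℝ(s̄) = conj Γ_ℝ(s)` for Deligne's `Γ_ℝ(s) = π^{-s/2} Γ(s/2)` (`Complex.Gamma_conj`,
`Complex.cpow_conj`). [folklore] -/
theorem Gammaℝ_conj (s : ℂ) : Gammaℝ (conj s) = conj (Gammaℝ s) := by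
  have harg : (π : ℂ).arg ≠ π := by
    rw [Complex.arg_ofReal_of_nonneg Real.pi_pos.le]
    exact Real.pi_ne_zero.symm
  rw [Gammaℝ_def, Gammaℝ_def, map_mul, ← Complex.Gamma_conj]
  congr 1
  · rw [show -conj s / 2 = conj (-s / 2) by simp [map_div₀, map_ofNat], Complex.cpow_conj _ _ harg,
      Complex.conj_ofReal]
  · congr 1
    simp [map_div₀, map_ofNat]

/-- `Λ(s̄) = conj Λ(s)` for the completed zeta function on the open right half-plane, where
`Λ = ζ Γ_ℝ` with `Γ_ℝ ≠ 0` (Mathlib `riemannZeta_def_of_ne_zero`, `riemannZeta_conj`).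
[folklore] -/
theorem completedRiemannZeta_conj_of_re_pos {s : ℂ} (hs : 0 < s.re) :
    completedRiemannZeta (conj s) = conj (completedRiemannZeta s) := by
  have h0 : s ≠ 0 := fun h ↦ by simp [h] at hs
  have h0' : conj s ≠ 0 := fun h ↦ h0 (by simpa using congrArg conj h)
  have hG : Gammaℝ s ≠ 0 := Gammaℝ_ne_zero_of_re_pos hs
  have hG' : Gammaℝ (conj s) ≠ 0 := Gammaℝ_ne_zero_of_re_pos (by simpa using hs)
  have e1 : completedRiemannZeta s = riemannZeta s * Gammaℝ s := by
    rw [riemannZeta_def_of_ne_zero h0, div_mul_cancel₀ _ hG]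
  have e2 : completedRiemannZeta (conj s) = riemannZeta (conj s) * Gammaℝ (conj s) := by
    rw [riemannZeta_def_of_ne_zero h0', div_mul_cancel₀ _ hG']
  rw [e2, e1, riemannZeta_conj, Gammaℝ_conj, map_mul]

/-- **`Λ(1/2 + it)` is real**: on the critical line `1 − s = s̄`, so
`Λ(s) = Λ(1 − s) = Λ(s̄) = conj Λ(s)` (functional equation `completedRiemannZeta_one_sub`;
Titchmarsh §2.1, §4.17). [cite: Titchmarsh1986, §4.17] -/
theorem completedRiemannZeta_im_eq_zero_of_re_eq_half (t : ℝ) :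
    (completedRiemannZeta (1 / 2 + t * I)).im = 0 := by
  set s : ℂ := 1 / 2 + t * I with hs_def
  have hs : 0 < s.re := by simp [hs_def]
  have h1 : 1 - s = conj s := by
    apply Complex.ext
    · simp [hs_def]; norm_num
    · simp [hs_def]
  have h := completedRiemannZeta_one_sub s
  rw [h1, completedRiemannZeta_conj_of_re_pos hs] at h
  exact Complex.conj_eq_iff_im.1 h

/-- `G(s(t)) ≠ 0`. [folklore] -/
theorem thetaGamma_thetaArg_ne_zero (t : ℝ) : thetaGamma (thetaArg t) ≠ 0 :=
  mul_ne_zero (Complex.exp_ne_zero _) (Complex.Gamma_ne_zero_of_re_pos (thetaArg_re_pos t))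

/-- `Γ_ℝ(1/2 + it) = π^{-1/4} G(s(t))`. [folklore] -/
theorem Gammaℝ_half_add_mul_I (t : ℝ) :
    Gammaℝ (1 / 2 + t * I) = ((Real.exp (-Real.log π / 4) : ℝ) : ℂ) * thetaGamma (thetaArg t) := by
  have hπ : (π : ℂ) ≠ 0 := by exact_mod_cast Real.pi_pos.ne'
  rw [Gammaℝ_def, thetaGamma, thetaArg, Complex.cpow_def_of_ne_zero hπ,
    ← Complex.ofReal_log Real.pi_pos.le,
    show ((1 : ℂ) / 2 + t * I) / 2 = 1 / 4 + t / 2 * I by ring, ← mul_assoc, Complex.ofReal_exp,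
    ← Complex.exp_add]
  congr 2
  push_cast
  ring

/-- **Discharge of `Literature.NumberTheory.LFunctions.im_cexp_theta_mul_zeta_eq_zero`** (Titchmarsh §4.17; Edwards §6.5):
`e^{iθ(t)} ζ(1/2 + it)` is real, being `π^{1/4} Λ(1/2 + it) / |G(s(t))|` with `Λ(1/2 + it)`
real. [cite: Titchmarsh1986, §4.17] -/
theorem im_cexp_theta_mul_zeta_eq_zero_holds : im_cexp_theta_mul_zeta_eq_zero := by
  intro t
  set s : ℂ := 1 / 2 + t * I with hs_def
  have hs : 0 < s.re := by simp [hs_def]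
  have h0 : s ≠ 0 := fun h ↦ by simp [h] at hs
  have hne : thetaGamma (thetaArg t) ≠ 0 := thetaGamma_thetaArg_ne_zero t
  have hnorm : (‖thetaGamma (thetaArg t)‖ : ℂ) ≠ 0 := by exact_mod_cast (norm_pos_iff.2 hne).ne'
  have hexp : ((Real.exp (-Real.log π / 4) : ℝ) : ℂ) ≠ 0 := by
    exact_mod_cast (Real.exp_pos _).ne'
  have key : thetaGamma (thetaArg t) / ‖thetaGamma (thetaArg t)‖
        * (completedRiemannZeta s / Gammaℝ s)
      = completedRiemannZeta s /
        ((‖thetaGamma (thetaArg t)‖ * Real.exp (-Real.log π / 4) : ℝ) : ℂ) := by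
    rw [hs_def, Gammaℝ_half_add_mul_I]
    push_cast
    field_simp
  rw [cexp_theta_mul_I_eq_thetaGamma_div_norm, riemannZeta_def_of_ne_zero h0, key,
    Complex.div_ofReal_im, completedRiemannZeta_im_eq_zero_of_re_eq_half, zero_div]

/-! ## Consequences for Hardy's function `Z` -/

/-- **Discharge of `Literature.NumberTheory.LFunctions.ofReal_hardyZ`**: `(Z(t) : ℂ) = e^{iθ(t)} ζ(1/2 + it)` (the interim proof
preserved in `RiemannSiegel.lean`, now fed by `im_cexp_theta_mul_zeta_eq_zero_holds`). [folklore] -/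
theorem ofReal_hardyZ_holds : ofReal_hardyZ := by
  intro t
  apply Complex.ext
  · rw [ofReal_re, hardyZ]
  · rw [ofReal_im, im_cexp_theta_mul_zeta_eq_zero_holds t]

/-- **Discharge of `Literature.NumberTheory.LFunctions.abs_hardyZ_eq_norm_riemannZeta`**: `|Z(t)| = |ζ(1/2 + it)|`
(Titchmarsh §4.17). [cite: Titchmarsh1986, §4.17] -/
theorem abs_hardyZ_eq_norm_riemannZeta_holds : abs_hardyZ_eq_norm_riemannZeta := by
  intro t
  rw [← Real.norm_eq_abs, ← Complex.norm_real, ofReal_hardyZ_holds t, norm_mul,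
    Complex.norm_exp_ofReal_mul_I, one_mul]

/-- **Discharge of `Literature.NumberTheory.LFunctions.hardyZ_eq_zero_iff`**: the real zeros of `Z` are exactly the zeros of `ζ`
on the critical line (Titchmarsh §4.17). [cite: Titchmarsh1986, §4.17] -/
theorem hardyZ_eq_zero_iff_holds : hardyZ_eq_zero_iff := by
  intro t
  rw [← abs_eq_zero, abs_hardyZ_eq_norm_riemannZeta_holds t, norm_eq_zero]

end Literature.NumberTheory.LFunctions

end
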